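import Literature.AlgebraicGeometry.Frobenioids.PermutationOfPrimes
import HarnessLib

/-!
# Frobenioids I, §3, Example 3.8 under the inverse-action convention: the printed law holds

Mochizuki, *The geometry of Frobenioids I: the general theory*, Kyushu J. Math. **62** (2008)
293–400, kurims text p. 71 [cite: MochizukiFrdI2008, Ex. 3.8 p.71].

`PermutationOfPrimes.lean` records (erratum candidate E1, convention-level) that under the LITERAL
reading of "`g ∈ G` that projects to `n ∈ N` acts on `V × W` by `(α(n), α(n)·n⁻¹)`" as the pull-back
`Φ(g)`, the `V, W`-coordinates of a composite in `End_C` carry the twist of the OTHER factor than in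
print.  This file PROVES the positive statement announced there: if `Φ(g)` is read as the INVERSE of
the displayed automorphism (the convention of "`n ∈ N` acts on `U` by `n⁻¹`" in the definition of `G`)
and `End_C` is coordinatised by `(u, v', w', n, m)` with `v' := α(n)·v`, `w' := α(n) n⁻¹·w`, then the
evident bijection `End_C ≃ M` IS an isomorphism of monoids for the PRINTED law of `M`
(`endLaw_covariant`, for every datum `α`).  So the printed Example 3.8 is exactly right under one global
convention; which convention the author intends is not decided here (recorded neutrally; audit E1).
-/

namespace Literature.AlgebraicGeometry.Frobenioids

open CategoryTheory

namespace Ex38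

open RatSemidirect

variable (P : Datum)

/-- `cV` is nowhere zero. [cite: MochizukiFrdI2008, Ex. 3.8 p.71] -/
theorem Datum.cV_ne_zero (n : N) : P.cV n ≠ 0 := ne_of_gt (P.αN n).2

/-- `cW` is nowhere zero. [cite: MochizukiFrdI2008, Ex. 3.8 p.71] -/
theorem Datum.cW_ne_zero (n : N) : P.cW n ≠ 0 :=
  mul_ne_zero (ne_of_gt (P.αN n).2) (inv_ne_zero (ne_of_gt n.2))

/-- `cV (n⁻¹) = (cV n)⁻¹`. [cite: MochizukiFrdI2008, Ex. 3.8 p.71] -/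
theorem Datum.cV_inv (n : N) : P.cV n⁻¹ = (P.cV n)⁻¹ := by
  have h : P.cV n⁻¹ * P.cV n = 1 := by rw [← Datum.cV_mul, inv_mul_cancel, Datum.cV_one]
  exact eq_inv_of_mul_eq_one_left h

/-- `cW (n⁻¹) = (cW n)⁻¹`. [cite: MochizukiFrdI2008, Ex. 3.8 p.71] -/
theorem Datum.cW_inv (n : N) : P.cW n⁻¹ = (P.cW n)⁻¹ := by
  have h : P.cW n⁻¹ * P.cW n = 1 := by rw [← Datum.cW_mul, inv_mul_cancel, Datum.cW_one]
  exact eq_inv_of_mul_eq_one_left h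

/-- The inverse-convention action: `g` acts on `V × W` by `(α(n)⁻¹, (α(n) n⁻¹)⁻¹)`.
[cite: MochizukiFrdI2008, Ex. 3.8 p.71] -/
def Datum.act' (g : G) : Multiplicative (ℚ × ℚ) →* Multiplicative (ℚ × ℚ) := P.act g⁻¹

/-- Values of `act'`. [cite: MochizukiFrdI2008, Ex. 3.8 p.71] -/
@[simp] theorem Datum.toAdd_act' (g : G) (z : Multiplicative (ℚ × ℚ)) :
    Multiplicative.toAdd (P.act' g z) =
      ((P.cV g.n)⁻¹ * (Multiplicative.toAdd z).1, (P.cW g.n)⁻¹ * (Multiplicative.toAdd z).2) := by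
  show Multiplicative.toAdd (P.act g⁻¹ z) = _
  rw [Datum.toAdd_act]
  show (P.cV g.n⁻¹ * _, P.cW g.n⁻¹ * _) = _
  rw [Datum.cV_inv, Datum.cW_inv]

/-- `act'` is compatible with the product of `G`. [cite: MochizukiFrdI2008, Ex. 3.8 p.71] -/
theorem Datum.act'_mul (g g' : G) : P.act' (g * g') = (P.act' g').comp (P.act' g) := by
  refine MonoidHom.ext fun z => Multiplicative.toAdd.injective ?_
  simp only [Datum.toAdd_act', MonoidHom.coe_comp, Function.comp_apply, G.mul_n, Datum.cV_mul,
    Datum.cW_mul, mul_inv, Prod.mk.injEq]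
  exact ⟨by ring, by ring⟩

/-- `act' 1 = id`. [cite: MochizukiFrdI2008, Ex. 3.8 p.71] -/
theorem Datum.act'_one : P.act' 1 = MonoidHom.id _ := by
  refine MonoidHom.ext fun z => Multiplicative.toAdd.injective ?_
  simp [Datum.toAdd_act']

/-- The monoid `Φ'` on `D` under the inverse convention, as a functor `Dᵒᵖ ⥤ CommMonCat`.
[cite: MochizukiFrdI2008, Ex. 3.8 p.71] -/
def Φ' : Dᵒᵖ ⥤ CommMonCat.{0} where
  obj _ := CommMonCat.of (Multiplicative (ℚ × ℚ))
  map f := CommMonCat.ofHom (P.act' (show G from f.unop))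
  map_id A := by
    ext x : 2
    change P.act' 1 x = x
    rw [Datum.act'_one]; rfl
  map_comp f g := by
    ext x : 2
    change P.act' ((show G from f.unop) * (show G from g.unop)) x = P.act' _ (P.act' _ x)
    rw [Datum.act'_mul]; rfl

/-- The object of `C' := F_{Φ'}`. [cite: MochizukiFrdI2008, Ex. 3.8 p.71] -/
abbrev obj' : ElemFrobenioid (Φ' P) := ElemFrobenioid.of (Φ' P) (SingleObj.star G)

/-- The push-forward coordinates `End_{C'} ≃ M`:
`(Base = (u, n), Div = (v, w), deg_Fr = m) ↦ (u, α(n)·v, α(n)n⁻¹·w, n, m)`.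
[cite: MochizukiFrdI2008, Ex. 3.8 p.71] -/
def endEquivSet' : End (obj' P) ≃ M P where
  toFun φ := ⟨(ElemFrobenioid.Base φ).u,
    P.cV (ElemFrobenioid.Base φ).n * (Multiplicative.toAdd (ElemFrobenioid.Div φ)).1,
    P.cW (ElemFrobenioid.Base φ).n * (Multiplicative.toAdd (ElemFrobenioid.Div φ)).2,
    (ElemFrobenioid.Base φ).n, ElemFrobenioid.degFr φ⟩
  invFun x := ElemFrobenioid.homMk (⟨x.u, x.n⟩ : G)
    (Multiplicative.ofAdd ((P.cV x.n)⁻¹ * x.v, (P.cW x.n)⁻¹ * x.w)) x.m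
  left_inv φ := by
    refine ElemFrobenioid.Hom.ext rfl ?_ rfl
    refine Multiplicative.toAdd.injective (Prod.ext ?_ ?_)
    · show (P.cV (ElemFrobenioid.Base φ).n)⁻¹ *
          (P.cV (ElemFrobenioid.Base φ).n * (Multiplicative.toAdd (ElemFrobenioid.Div φ)).1) = _
      rw [← mul_assoc, inv_mul_cancel₀ (P.cV_ne_zero _), one_mul]
    · show (P.cW (ElemFrobenioid.Base φ).n)⁻¹ *
          (P.cW (ElemFrobenioid.Base φ).n * (Multiplicative.toAdd (ElemFrobenioid.Div φ)).2) = _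
      rw [← mul_assoc, inv_mul_cancel₀ (P.cW_ne_zero _), one_mul]
  right_inv x := by
    refine M.ext rfl ?_ ?_ rfl rfl
    · show P.cV x.n * ((P.cV x.n)⁻¹ * x.v) = x.v
      rw [← mul_assoc, mul_inv_cancel₀ (P.cV_ne_zero _), one_mul]
    · show P.cW x.n * ((P.cW x.n)⁻¹ * x.w) = x.w
      rw [← mul_assoc, mul_inv_cancel₀ (P.cW_ne_zero _), one_mul]

/-- **Example 3.8 under the inverse-action convention** (PROVED, every datum `α`): with
`Φ(g) := (α(n)⁻¹, (α(n)n⁻¹)⁻¹)` and the coordinates `(u, α(n)v, α(n)n⁻¹w, n, m)` on `End_C`, the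
bijection `End_C ≃ M` is multiplicative for the PRINTED law `(u₁ + n₁⁻¹u₂, v₁ + m₁α(n₁)v₂,
w₁ + m₁α(n₁)n₁⁻¹w₂, n₁n₂, m₁m₂)` of FrdI p. 71 (composition `φ ∘ ψ` via Def. 1.1 (iii)).
[cite: MochizukiFrdI2008, Ex. 3.8 p.71] -/
theorem endLaw_covariant (φ ψ : End (obj' P)) :
    endEquivSet' P (φ * ψ) = endEquivSet' P φ * endEquivSet' P ψ := by
  have h1 : (ElemFrobenioid.Base (φ * ψ)).n = (ElemFrobenioid.Base φ).n * (ElemFrobenioid.Base ψ).n := by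
    show ((show G from ElemFrobenioid.Base φ) * (show G from ElemFrobenioid.Base ψ)).n = _
    rw [G.mul_n]
  have h2 : Multiplicative.toAdd (ElemFrobenioid.Div (φ * ψ)) =
      ((P.cV (ElemFrobenioid.Base ψ).n)⁻¹ * (Multiplicative.toAdd (ElemFrobenioid.Div φ)).1 +
          ((ElemFrobenioid.degFr φ : ℕ) : ℚ) * (Multiplicative.toAdd (ElemFrobenioid.Div ψ)).1,
        (P.cW (ElemFrobenioid.Base ψ).n)⁻¹ * (Multiplicative.toAdd (ElemFrobenioid.Div φ)).2 +
          ((ElemFrobenioid.degFr φ : ℕ) : ℚ) * (Multiplicative.toAdd (ElemFrobenioid.Div ψ)).2) := by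
    show Multiplicative.toAdd (P.act' (ElemFrobenioid.Base ψ) (ElemFrobenioid.Div φ) *
        (show Multiplicative (ℚ × ℚ) from ElemFrobenioid.Div ψ) ^ (ElemFrobenioid.degFr φ : ℕ)) = _
    simp only [toAdd_mul, toAdd_pow, Datum.toAdd_act', nsmul_eq_mul]
    rfl
  refine M.ext rfl ?_ ?_ rfl (mul_comm _ _)
  · show P.cV (ElemFrobenioid.Base (φ * ψ)).n * (Multiplicative.toAdd (ElemFrobenioid.Div (φ * ψ))).1 =
      P.cV (ElemFrobenioid.Base φ).n * (Multiplicative.toAdd (ElemFrobenioid.Div φ)).1 +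
        ((ElemFrobenioid.degFr φ : ℕ) : ℚ) * P.cV (ElemFrobenioid.Base φ).n *
          (P.cV (ElemFrobenioid.Base ψ).n * (Multiplicative.toAdd (ElemFrobenioid.Div ψ)).1)
    rw [h1, h2, Datum.cV_mul]
    have hψ := P.cV_ne_zero (ElemFrobenioid.Base ψ).n
    field_simp
  · show P.cW (ElemFrobenioid.Base (φ * ψ)).n * (Multiplicative.toAdd (ElemFrobenioid.Div (φ * ψ))).2 =
      P.cW (ElemFrobenioid.Base φ).n * (Multiplicative.toAdd (ElemFrobenioid.Div φ)).2 +
        ((ElemFrobenioid.degFr φ : ℕ) : ℚ) * P.cW (ElemFrobenioid.Base φ).n *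
          (P.cW (ElemFrobenioid.Base ψ).n * (Multiplicative.toAdd (ElemFrobenioid.Div ψ)).2)
    rw [h1, h2, Datum.cW_mul]
    have hψ := P.cW_ne_zero (ElemFrobenioid.Base ψ).n
    field_simp

/-! ### Addendum (referee PASS-C3, C3-Ff): "the [manifestly non-dilating] monoid on `D`" -/

/-- FrdI Ex. 3.8, the bracket "the [manifestly non-dilating] monoid on `D`" (p. 71; PROVED, ref-c
C3-Ff): `V × W = ℚ × ℚ` is a group, so `(V × W)^char` is trivial and every `Φ(g)` induces the identity on
it; Def. 1.1 (i) holds trivially. [cite: MochizukiFrdI2008, Ex. 3.8 p.71] -/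
theorem isNonDilatingOn_Φ : IsNonDilatingOn (Φ P) := by
  intro A f
  change IsNonDilating (P.act (show G from f))
  intro _
  refine MonoidHom.ext fun a => ?_
  obtain ⟨x, rfl⟩ := Associates.mk_surjective a
  rw [associatesMap_mk, MonoidHom.id_apply, Associates.mk_eq_mk_iff_associated]
  exact ⟨toUnits ((P.act (show G from f) x)⁻¹ * x), by rw [val_toUnits_apply, mul_inv_cancel_left]⟩

end Ex38

end Literature.AlgebraicGeometry.Frobenioids
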